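import Summits.BirchSwinnertonDyer.BirchSwinnertonDyer.Theses.ThetaPartnerAtTwo
import Summits.BirchSwinnertonDyer.BirchSwinnertonDyer.Theorems.ThetaPartnerAtTwoSignedTransportAtTwoRankZeroOfPrint
import HarnessLib

/-!
# K1P `SignedTransportAtTwoRankZeroOfPub` — closer

The route's rank-zero-of-print twin of K1 `SignedTransportAtTwo` (PUB⁴ = conjuncts 1, 2, 3, 5 of
`PublishedInputsGreenbergControlAtTwo` → Gross–Zagier–Kolyvagin fact → `MazurTateCongruenceAtTwoR` → the K1 text with
`A.analyticRank = 0` inserted after `A.HasCM`) is exactly the landed theorem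
`SignedTransportAtTwo.signedTransportAtTwo_rankZero_of_print4` (p600518, lead prover bsd-wall-tp2-p1 g8).
BSD is not proved by any of this.
-/

set_option autoImplicit false
-- D-0017: single-problem summit, so `Summit.BirchSwinnertonDyer.BirchSwinnertonDyer.…` repeats a namespace BY DESIGN.
set_option linter.dupNamespace false

namespace Summit.BirchSwinnertonDyer.BirchSwinnertonDyer.Theorems

/-- K1P holds: the print road PUB⁴ → GZK → Mazur–Tate congruence at 2 → K1 at a rank-zero CM partner, by the landed
`SignedTransportAtTwo.signedTransportAtTwo_rankZero_of_print4`. -/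
theorem signedTransportAtTwoRankZeroOfPub_proof :
    Summit.BirchSwinnertonDyer.BirchSwinnertonDyer.Theses.ThetaPartnerAtTwo.SignedTransportAtTwoRankZeroOfPub :=
  fun hG1 hG2 hG3 hG5 hGZK hMT =>
    SignedTransportAtTwo.signedTransportAtTwo_rankZero_of_print4 hG1 hG2 hG3 hG5 hGZK hMT

end Summit.BirchSwinnertonDyer.BirchSwinnertonDyer.Theorems
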